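import Summits.CriticalPhenomena.PercolationContinuityZ3.Theorems.PercNearOneGluingNoHeavyLowerTailSahiGridPatternTheta
import Summits.CriticalPhenomena.PercolationContinuityZ3.Theorems.PercNearOneGluingNoHeavyLowerTailSahiGridPatternHarris

/-!
# `NoHeavyLowerTail` (crux stmt-CriticalPhenomena-4575), Sahi programme P1: **THE CELL FORM OF A JUNTA CYLINDER** (every `k`, every `n`)

Support file (Sahi cell, seat `prim-sahi-p1`, generation 11; `--supports stmt-CriticalPhenomena-4575`).  Pure proofs plus bookkeeping
definitions (`glue`/`freeOf`/`cellOf`, `cylSet`, `fibre`, `sect`, the cell statistics `cellT`, `cellN`, the coefficient functions `lamU`,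
`klCoef`, `sliceBeta`, and the pairings `pairT`, `pairN`); no `sorry`, standard axioms.

THE MATHEMATICS.  Write a point of `[3]^{n+k}` as `glue ξ q` (`ξ ∈ [3]^n` the FREE block = first `n` axes, `q ∈ [3]^k` the JUNTA block =
last `k` axes) and let `cylSet U = {x : cellOf x ∈ U}` be the cylinder over `U ⊆ [3]^k` (a `k`-junta first slot).  For `B, C ⊆ [3]^{n+k}`
and cells `q, r` put, with `B_q = {ξ : glue ξ q ∈ B}` the cell fibres,
  `cellT B C q r = 2^n · #(B_q ∩ C_r)`,   `cellN B C q r = #{(ξ,η) totally distinct : ξ ∈ B_q, η ∈ C_r}`.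
**`sStarD_cylSet_eq` (THE CELL FORM)** — the block-cylinder identity of the generation-10 memo §4 / census §32 in closed form, in Lean:
    `sStarD (cylSet U) B C = Σ_q λ_U(q)·cellT B C q q − Σ_{q,r} Θ_U(q,r)·cellN B C q r`,
`λ_U(q) = 2^{k+1}·1_U(q) − ν_U(q)` (`lamU`), `Θ_U = thetaVal U` (`[q δ̸ r](1_U(q)+1_U(r)−1_U(q̄r))`).  So for a `k`-junta first slot the
pattern functional in dimension `n+k` is ONE linear form in the `2·9^k` cell statistics, uniformly in `n` — the object behind the
uniform slice decomposability USD(k) (certificates: HOME/prim-sahi-p1/certs/gen9/junta3, census §32).  Ingredients: the slice form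
`sliceForm_eq`, `ν_{cyl U}(glue ξ q) = 2^n ν_U(q)` (`nuCount_cylSet`), `Θ_{cyl U}(glue ξ q, glue η r) = [ξ δ̸ η]Θ_U(q,r)` (`thetaVal_cylSet`).
The atoms of the cylinder-closure LP (Harris on fibres, good-slot atoms, Kleitman atoms, generator products) and the linear-certificate
principle are in the companion file `…SahiGridPatternCellAtoms`. [this work]
-/

namespace Summit.CriticalPhenomena.PercolationContinuityZ3.Theorems.SahiGridPattern

open Finset SahiGrid3
open scoped BigOperators FinsetFamily

variable {n k : ℕ}

/-! ### Gluing a free block and a junta block -/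

/-- `glue ξ q ∈ [3]^{n+k}`: the point with free coordinates `ξ` (first `n` axes) and cell `q` (last `k` axes). [this work] -/
def glue (ξ : Pd n) (q : Pd k) : Pd (n + k) := Fin.append ξ q

/-- The free part of a point (first `n` axes). [this work] -/
def freeOf (x : Pd (n + k)) : Pd n := fun a => x (Fin.castAdd k a)

/-- The cell of a point (last `k` axes). [this work] -/
def cellOf (x : Pd (n + k)) : Pd k := fun a => x (Fin.natAdd n a)

/-- Free coordinates of a glued point. [this work] -/
@[simp] theorem glue_castAdd (ξ : Pd n) (q : Pd k) (a : Fin n) : glue ξ q (Fin.castAdd k a) = ξ a := by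
  simp [glue]

/-- Junta coordinates of a glued point. [this work] -/
@[simp] theorem glue_natAdd (ξ : Pd n) (q : Pd k) (a : Fin k) : glue ξ q (Fin.natAdd n a) = q a := by
  simp [glue]

/-- `freeOf ∘ glue`. [this work] -/
@[simp] theorem freeOf_glue (ξ : Pd n) (q : Pd k) : freeOf (glue ξ q) = ξ := by
  funext a; simp [freeOf]

/-- `cellOf ∘ glue`. [this work] -/
@[simp] theorem cellOf_glue (ξ : Pd n) (q : Pd k) : cellOf (glue ξ q) = q := by
  funext a; simp [cellOf]

/-- Every point is glued from its two parts. [this work] -/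
theorem glue_freeOf_cellOf (x : Pd (n + k)) : glue (freeOf x) (cellOf x) = x := by
  funext a
  refine Fin.addCases (fun b => ?_) (fun b => ?_) a
  · simp [freeOf]
  · simp [cellOf]

/-- Gluing as an equivalence `[3]^n × [3]^k ≃ [3]^{n+k}`. [this work] -/
def glueEquiv : Pd n × Pd k ≃ Pd (n + k) where
  toFun := fun p => glue p.1 p.2
  invFun := fun x => (freeOf x, cellOf x)
  left_inv := fun p => by simp
  right_inv := fun x => glue_freeOf_cellOf x

/-- Splitting a sum over `[3]^{n+k}` into free part and cell. [this work] -/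
theorem sum_glue {M : Type*} [AddCommMonoid M] (F : Pd (n + k) → M) :
    (∑ x, F x) = ∑ ξ : Pd n, ∑ q : Pd k, F (glue ξ q) := by
  rw [← (glueEquiv (n := n) (k := k)).sum_comp, Fintype.sum_prod_type]
  rfl

/-- `glue` is injective in both arguments. [this work] -/
theorem glue_eq_glue_iff {ξ η : Pd n} {q r : Pd k} : glue ξ q = glue η r ↔ ξ = η ∧ q = r := by
  constructor
  · intro h
    have h' := congrArg (glueEquiv (n := n) (k := k)).symm h
    have e1 : (glueEquiv (n := n) (k := k)).symm (glue ξ q) = (ξ, q) := (glueEquiv (n := n) (k := k)).left_inv (ξ, q)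
    have e2 : (glueEquiv (n := n) (k := k)).symm (glue η r) = (η, r) := (glueEquiv (n := n) (k := k)).left_inv (η, r)
    rw [e1, e2] at h'
    exact ⟨congrArg Prod.fst h', congrArg Prod.snd h'⟩
  · rintro ⟨rfl, rfl⟩; rfl

/-- Totally distinct glued points: both parts totally distinct. [this work] -/
theorem totDist_glue (ξ η : Pd n) (q r : Pd k) :
    TotDist (glue ξ q) (glue η r) = true ↔ (TotDist ξ η = true ∧ TotDist q r = true) := by
  simp only [totDist_iff]
  constructor
  · intro h
    exact ⟨fun a => by simpa using h (Fin.castAdd k a), fun a => by simpa using h (Fin.natAdd n a)⟩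
  · rintro ⟨h1, h2⟩ a
    refine Fin.addCases (fun b => ?_) (fun b => ?_) a
    · simpa using h1 b
    · simpa using h2 b

/-- The third point of two glued points is glued from the third points. [this work] -/
theorem thirdPt_glue (ξ η : Pd n) (q r : Pd k) : thirdPt (glue ξ q) (glue η r) = glue (thirdPt ξ η) (thirdPt q r) := by
  funext a
  refine Fin.addCases (fun b => ?_) (fun b => ?_) a
  · simp [thirdPt]
  · simp [thirdPt]

/-- Order on glued points. [this work] -/
theorem glue_le_glue_iff {ξ η : Pd n} {q r : Pd k} : glue ξ q ≤ glue η r ↔ (ξ ≤ η ∧ q ≤ r) := by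
  constructor
  · intro h
    exact ⟨fun a => by simpa using h (Fin.castAdd k a), fun a => by simpa using h (Fin.natAdd n a)⟩
  · rintro ⟨h1, h2⟩ a
    refine Fin.addCases (fun b => ?_) (fun b => ?_) a
    · simpa using h1 b
    · simpa using h2 b

/-! ### Reordering iterated sums (bookkeeping) -/

/-- `Σ_a Σ_b Σ_c = Σ_c Σ_a Σ_b`. [this work] -/
theorem sum_comm3 {α β γ : Type*} [Fintype α] [Fintype β] [Fintype γ] (F : α → β → γ → ℤ) :
    (∑ a, ∑ b, ∑ c, F a b c) = ∑ c, ∑ a, ∑ b, F a b c := by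
  calc (∑ a, ∑ b, ∑ c, F a b c) = ∑ a, ∑ c, ∑ b, F a b c := Finset.sum_congr rfl fun a _ => Finset.sum_comm
    _ = ∑ c, ∑ a, ∑ b, F a b c := Finset.sum_comm

/-- `Σ_a Σ_b Σ_c Σ_e = Σ_c Σ_e Σ_a Σ_b`. [this work] -/
theorem sum_comm4 {α β γ δ : Type*} [Fintype α] [Fintype β] [Fintype γ] [Fintype δ] (F : α → β → γ → δ → ℤ) :
    (∑ a, ∑ b, ∑ c, ∑ e, F a b c e) = ∑ c, ∑ e, ∑ a, ∑ b, F a b c e := by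
  calc (∑ a, ∑ b, ∑ c, ∑ e, F a b c e) = ∑ a, ∑ e, ∑ b, ∑ c, F a b c e :=
        Finset.sum_congr rfl fun a _ => sum_comm3 (fun b c e => F a b c e)
    _ = ∑ e, ∑ a, ∑ b, ∑ c, F a b c e := Finset.sum_comm
    _ = ∑ e, ∑ c, ∑ a, ∑ b, F a b c e := Finset.sum_congr rfl fun e _ => sum_comm3 (fun a b c => F a b c e)
    _ = ∑ c, ∑ e, ∑ a, ∑ b, F a b c e := Finset.sum_comm

/-- `Σ_a Σ_b Σ_c Σ_e = Σ_b Σ_e Σ_a Σ_c`. [this work] -/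
theorem sum_comm4' {α β γ δ : Type*} [Fintype α] [Fintype β] [Fintype γ] [Fintype δ] (F : α → β → γ → δ → ℤ) :
    (∑ a, ∑ b, ∑ c, ∑ e, F a b c e) = ∑ b, ∑ e, ∑ a, ∑ c, F a b c e := by
  calc (∑ a, ∑ b, ∑ c, ∑ e, F a b c e) = ∑ b, ∑ a, ∑ c, ∑ e, F a b c e := Finset.sum_comm
    _ = ∑ b, ∑ a, ∑ e, ∑ c, F a b c e :=
        Finset.sum_congr rfl fun b _ => Finset.sum_congr rfl fun a _ => Finset.sum_comm
    _ = ∑ b, ∑ e, ∑ a, ∑ c, F a b c e := Finset.sum_congr rfl fun b _ => Finset.sum_comm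

/-! ### Cylinders, fibres, sections -/

/-- The cylinder over `U ⊆ [3]^k`: points whose cell lies in `U`. [this work] -/
def cylSet (U : Finset (Pd k)) : Finset (Pd (n + k)) := univ.filter fun x => cellOf x ∈ U

/-- Membership of a glued point in the cylinder. [this work] -/
@[simp] theorem glue_mem_cylSet {U : Finset (Pd k)} {ξ : Pd n} {q : Pd k} : glue ξ q ∈ (cylSet U : Finset (Pd (n + k))) ↔ q ∈ U := by
  unfold cylSet; simp

/-- Indicator of the cylinder. [this work] -/
theorem ind_cylSet_glue (U : Finset (Pd k)) (ξ : Pd n) (q : Pd k) : ind (cylSet U : Finset (Pd (n + k))) (glue ξ q) = ind U q := by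
  unfold ind; simp

/-- The cylinder over an up-set is an up-set. [this work] -/
theorem isUpperSet_cylSet {U : Finset (Pd k)} (hU : IsUpperSet (U : Set (Pd k))) :
    IsUpperSet ((cylSet U : Finset (Pd (n + k))) : Set (Pd (n + k))) := by
  intro x y hxy hx
  rw [Finset.mem_coe] at hx ⊢
  unfold cylSet at hx ⊢
  rw [mem_filter] at hx ⊢
  exact ⟨mem_univ _, hU (fun a => hxy (Fin.natAdd n a)) hx.2⟩

/-- The cylinder set "depends only on the junta block". [this work] -/
theorem mem_cylSet_iff (U : Finset (Pd k)) (x : Pd (n + k)) : x ∈ (cylSet U : Finset (Pd (n + k))) ↔ cellOf x ∈ U := by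
  unfold cylSet; simp

/-- Cell fibre `B_q = {ξ : glue ξ q ∈ B} ⊆ [3]^n`. [this work] -/
def fibre (B : Finset (Pd (n + k))) (q : Pd k) : Finset (Pd n) := univ.filter fun ξ => glue ξ q ∈ B

/-- Section `B^ξ = {q : glue ξ q ∈ B} ⊆ [3]^k`. [this work] -/
def sect (B : Finset (Pd (n + k))) (ξ : Pd n) : Finset (Pd k) := univ.filter fun q => glue ξ q ∈ B

/-- Indicator of a fibre. [this work] -/
theorem ind_fibre (B : Finset (Pd (n + k))) (q : Pd k) (ξ : Pd n) : ind (fibre B q) ξ = ind B (glue ξ q) := by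
  unfold ind fibre; simp

/-- Indicator of a section. [this work] -/
theorem ind_sect (B : Finset (Pd (n + k))) (ξ : Pd n) (q : Pd k) : ind (sect B ξ) q = ind B (glue ξ q) := by
  unfold ind sect; simp

/-- Fibres of up-sets are up-sets. [this work] -/
theorem isUpperSet_fibre {B : Finset (Pd (n + k))} (hB : IsUpperSet (B : Set (Pd (n + k)))) (q : Pd k) :
    IsUpperSet ((fibre B q : Finset (Pd n)) : Set (Pd n)) := by
  intro ξ η hle h
  rw [Finset.mem_coe] at h ⊢
  unfold fibre at h ⊢
  rw [mem_filter] at h ⊢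
  exact ⟨mem_univ _, hB (glue_le_glue_iff.2 ⟨hle, le_rfl⟩) h.2⟩

/-- Sections of up-sets are up-sets. [this work] -/
theorem isUpperSet_sect {B : Finset (Pd (n + k))} (hB : IsUpperSet (B : Set (Pd (n + k)))) (ξ : Pd n) :
    IsUpperSet ((sect B ξ : Finset (Pd k)) : Set (Pd k)) := by
  intro q r hle h
  rw [Finset.mem_coe] at h ⊢
  unfold sect at h ⊢
  rw [mem_filter] at h ⊢
  exact ⟨mem_univ _, hB (glue_le_glue_iff.2 ⟨le_rfl, hle⟩) h.2⟩

/-! ### Cell statistics and coefficient functions -/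

/-- `cellT B C q r = 2^n · #(B_q ∩ C_r)`. [this work] -/
def cellT (B C : Finset (Pd (n + k))) (q r : Pd k) : ℤ := 2 ^ n * ∑ ξ : Pd n, ind B (glue ξ q) * ind C (glue ξ r)

/-- `cellN B C q r = #{(ξ,η) : ξ δ̸ η, glue ξ q ∈ B, glue η r ∈ C}`. [this work] -/
def cellN (B C : Finset (Pd (n + k))) (q r : Pd k) : ℤ :=
  ∑ ξ : Pd n, ∑ η : Pd n, ind B (glue ξ q) * ind C (glue η r) * (if TotDist ξ η = true then (1:ℤ) else 0)

/-- `λ_U(q) = 2^{k+1}·1_U(q) − ν_U(q)` (the diagonal of the slice form). [this work] -/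
def lamU (U : Finset (Pd k)) (q : Pd k) : ℤ := 2 * (2:ℤ) ^ k * ind U q - (nuCount U q : ℤ)

/-- Kleitman coefficients around the cell `q`: `klCoef U q r = [r δ̸ q](1_U(r) − 1_U(third point))`. [this work] -/
def klCoef (U : Finset (Pd k)) (q r : Pd k) : ℤ := if TotDist r q = true then ind U r - ind U (thirdPt r q) else 0

/-- The slice `β_V(q,r) = Σ_{p∈V} t_k(p,q,r)` of the pattern tensor. [this work] -/
def sliceBeta (V : Finset (Pd k)) (q r : Pd k) : ℤ := ∑ p ∈ V, tcD p q r

/-- Pairing a coefficient matrix with `cellT`. [this work] -/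
def pairT (M : Pd k → Pd k → ℤ) (B C : Finset (Pd (n + k))) : ℤ := ∑ q : Pd k, ∑ r : Pd k, M q r * cellT B C q r

/-- Pairing a coefficient matrix with `cellN`. [this work] -/
def pairN (M : Pd k → Pd k → ℤ) (B C : Finset (Pd (n + k))) : ℤ := ∑ q : Pd k, ∑ r : Pd k, M q r * cellN B C q r

/-! ### The cell form of the pattern functional of a cylinder -/

/-- Number of points totally distinct from a given one: `2^n`. [this work] -/
theorem sum_ite_totDist_eq_pow (ξ : Pd n) : (∑ η : Pd n, if TotDist η ξ = true then (1:ℤ) else 0) = 2 ^ n := by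
  rw [← Finset.sum_filter, sum_totDist_eq_sum_sets ξ (fun _ => (1:ℤ))]
  simp

/-- `ν` of a cylinder: `ν_{cyl U}(glue ξ q) = 2^n · ν_U(q)`. [this work] -/
theorem nuCount_cylSet (U : Finset (Pd k)) (ξ : Pd n) (q : Pd k) :
    (nuCount (cylSet U : Finset (Pd (n + k))) (glue ξ q) : ℤ) = 2 ^ n * (nuCount U q : ℤ) := by
  unfold nuCount
  rw [Finset.card_filter, Finset.card_filter, Nat.cast_sum, Nat.cast_sum]
  -- pass to sums over all points with indicators
  have h1 : (∑ p ∈ (cylSet U : Finset (Pd (n + k))), ((if TotDist p (glue ξ q) = true then 1 else 0 : ℕ) : ℤ)) =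
      ∑ p : Pd (n + k), ind (cylSet U : Finset (Pd (n + k))) p * (if TotDist p (glue ξ q) = true then (1:ℤ) else 0) := by
    rw [← Finset.sum_subset (Finset.subset_univ (cylSet U : Finset (Pd (n + k)))) (fun p _ hp => by unfold ind; rw [if_neg hp]; ring)]
    refine Finset.sum_congr rfl fun p hp => ?_
    unfold ind; rw [if_pos hp]; push_cast; ring
  have h2 : (∑ p ∈ U, ((if TotDist p q = true then 1 else 0 : ℕ) : ℤ)) =
      ∑ p : Pd k, ind U p * (if TotDist p q = true then (1:ℤ) else 0) := by
    rw [← Finset.sum_subset (Finset.subset_univ U) (fun p _ hp => by unfold ind; rw [if_neg hp]; ring)]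
    refine Finset.sum_congr rfl fun p hp => ?_
    unfold ind; rw [if_pos hp]; push_cast; ring
  rw [h1, h2, sum_glue]
  have h3 : ∀ (η : Pd n) (r : Pd k), ind (cylSet U : Finset (Pd (n + k))) (glue η r) * (if TotDist (glue η r) (glue ξ q) = true then (1:ℤ) else 0)
      = (if TotDist η ξ = true then (1:ℤ) else 0) * (ind U r * (if TotDist r q = true then (1:ℤ) else 0)) := by
    intro η r
    rw [ind_cylSet_glue]
    by_cases h : TotDist (glue η r) (glue ξ q) = true
    · rw [if_pos h]; rw [totDist_glue] at h; rw [if_pos h.1, if_pos h.2]; ring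
    · rw [if_neg h]; rw [totDist_glue, not_and_or] at h
      rcases h with h | h
      · rw [if_neg h]; ring
      · rw [if_neg h]; ring
  simp_rw [h3]
  rw [Finset.sum_congr rfl fun η _ => (Finset.mul_sum _ _ _).symm, ← Finset.sum_mul, sum_ite_totDist_eq_pow]

/-- `Θ` of a cylinder factors: `Θ_{cyl U}(glue ξ q, glue η r) = [ξ δ̸ η] · Θ_U(q,r)`. [this work] -/
theorem thetaVal_cylSet (U : Finset (Pd k)) (ξ η : Pd n) (q r : Pd k) :
    thetaVal (cylSet U : Finset (Pd (n + k))) (glue ξ q) (glue η r) = (if TotDist ξ η = true then (1:ℤ) else 0) * thetaVal U q r := by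
  unfold thetaVal
  by_cases h : TotDist (glue ξ q) (glue η r) = true
  · rw [if_pos h]
    rw [totDist_glue] at h
    rw [if_pos h.1, if_pos h.2, thirdPt_glue, ind_cylSet_glue, ind_cylSet_glue, ind_cylSet_glue]; ring
  · rw [if_neg h]
    rw [totDist_glue, not_and_or] at h
    rcases h with h | h
    · rw [if_neg h]; ring
    · rw [if_neg h]; split_ifs <;> ring

/-- Restricted double sum as an indicator-weighted full sum. [this work] -/
theorem sum_sum_mem_eq_ind (B C : Finset (Pd (n + k))) (F : Pd (n + k) → Pd (n + k) → ℤ) :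
    (∑ x ∈ B, ∑ y ∈ C, F x y) = ∑ x, ∑ y, ind B x * ind C y * F x y := by
  rw [← Finset.sum_subset (Finset.subset_univ B) (fun x _ hx => by
        refine Finset.sum_eq_zero fun y _ => ?_
        unfold ind; rw [if_neg hx]; ring)]
  refine Finset.sum_congr rfl fun x hx => ?_
  rw [← Finset.sum_subset (Finset.subset_univ C) (fun y _ hy => by unfold ind; rw [if_neg hy]; ring)]
  refine Finset.sum_congr rfl fun y hy => ?_
  unfold ind; rw [if_pos hx, if_pos hy]; ring

/-- **THE CELL FORM** (every `n`, every `k`): for `U ⊆ [3]^k` and all `B, C ⊆ [3]^{n+k}`,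
`sStarD (cylSet U) B C = Σ_q λ_U(q)·cellT B C q q − Σ_{q,r} Θ_U(q,r)·cellN B C q r`. [this work] -/
theorem sStarD_cylSet_eq (U : Finset (Pd k)) (B C : Finset (Pd (n + k))) :
    sStarD (cylSet U : Finset (Pd (n + k))) B C =
      (∑ q : Pd k, lamU U q * cellT B C q q) - ∑ q : Pd k, ∑ r : Pd k, thetaVal U q r * cellN B C q r := by
  -- slice form, summed over B × C
  have h0 : sStarD (cylSet U : Finset (Pd (n + k))) B C =
      ∑ x ∈ B, ∑ y ∈ C, ((if x = y then 2 * (2:ℤ) ^ (n + k) * ind (cylSet U : Finset (Pd (n + k))) x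
        - (nuCount (cylSet U : Finset (Pd (n + k))) x : ℤ) else 0) - thetaVal (cylSet U : Finset (Pd (n + k))) x y) := by
    rw [sStarD_eq_sum_tcD, Finset.sum_comm]
    refine Finset.sum_congr rfl fun x _ => ?_
    rw [Finset.sum_comm]
    refine Finset.sum_congr rfl fun y _ => ?_
    exact sliceForm_eq _ x y
  rw [h0, sum_sum_mem_eq_ind, sum_glue]
  simp_rw [sum_glue (k := k) (n := n)]
  -- now every point is glued; rewrite the summand
  have hsummand : ∀ (ξ : Pd n) (q : Pd k) (η : Pd n) (r : Pd k),
      ind B (glue ξ q) * ind C (glue η r) *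
        ((if glue ξ q = glue η r then 2 * (2:ℤ) ^ (n + k) * ind (cylSet U : Finset (Pd (n + k))) (glue ξ q)
          - (nuCount (cylSet U : Finset (Pd (n + k))) (glue ξ q) : ℤ) else 0) - thetaVal (cylSet U : Finset (Pd (n + k))) (glue ξ q) (glue η r))
      = (if (ξ = η ∧ q = r) then (2:ℤ) ^ n * (lamU U q * (ind B (glue ξ q) * ind C (glue ξ q))) else 0)
        - thetaVal U q r * (ind B (glue ξ q) * ind C (glue η r) * (if TotDist ξ η = true then (1:ℤ) else 0)) := by
    intro ξ q η r
    rw [thetaVal_cylSet, nuCount_cylSet, ind_cylSet_glue]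
    by_cases h : (ξ = η ∧ q = r)
    · rw [if_pos (glue_eq_glue_iff.2 h), if_pos h]
      obtain ⟨rfl, rfl⟩ := h
      unfold lamU; rw [pow_add]; ring
    · rw [if_neg (fun h' => h (glue_eq_glue_iff.1 h')), if_neg h]; ring
  simp_rw [hsummand]
  simp only [Finset.sum_sub_distrib]
  congr 1
  · -- diagonal part
    have hd : ∀ (ξ : Pd n) (q : Pd k), (∑ η : Pd n, ∑ r : Pd k,
        (if (ξ = η ∧ q = r) then (2:ℤ) ^ n * (lamU U q * (ind B (glue ξ q) * ind C (glue ξ q))) else 0)) =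
        (2:ℤ) ^ n * (lamU U q * (ind B (glue ξ q) * ind C (glue ξ q))) := by
      intro ξ q
      rw [Finset.sum_eq_single ξ (fun η _ hne => Finset.sum_eq_zero fun r _ => if_neg (fun h => hne h.1.symm)) (fun h => absurd (mem_univ ξ) h)]
      rw [Finset.sum_eq_single q (fun r _ hne => if_neg (fun h => hne h.2.symm)) (fun h => absurd (mem_univ q) h)]
      rw [if_pos ⟨rfl, rfl⟩]
    simp_rw [hd]
    rw [Finset.sum_comm]
    refine Finset.sum_congr rfl fun q _ => ?_
    unfold cellT
    rw [Finset.mul_sum, Finset.mul_sum]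
    refine Finset.sum_congr rfl fun ξ _ => ?_
    ring
  · -- theta part: reorder the four sums
    unfold cellN
    simp_rw [Finset.mul_sum]
    -- LHS: Σ ξ, Σ q, Σ η, Σ r ;  RHS: Σ q, Σ r, Σ ξ, Σ η
    exact sum_comm4' (fun ξ q η r => thetaVal U q r * (ind B (glue ξ q) * ind C (glue η r) * (if TotDist ξ η = true then (1:ℤ) else 0)))

end Summit.CriticalPhenomena.PercolationContinuityZ3.Theorems.SahiGridPattern
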